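import Mathlib
import HarnessLib

/-!
# Dieudonné 1949 / Flanders 1962: linear spaces of singular matrices have dimension at most
# `n(n-1)`, with equality only for a common kernel vector or a common cokernel vector

Topic `Literature/LinearAlgebra` (cell `val-lit`, seat t19 g6; brick A of the elementary route to
Makam–Wigderson 2021 Thm 1.13, see `HOME/np/NOTE-t19g6-MW21-Thm113-sizing.md`). THEOREM-ONLY apart
from two bookkeeping linear maps (`Flanders.colRow`, `Flanders.blocks₁₁`); no named facts.
Honest framing: classical linear algebra; nothing here bears on `VP ≠ VNP`, which is NOT proved.

## The statements (over `ℂ`)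

* `finrank_le_rank_mul_of_forall_rank_le` (**Flanders 1962, Thm. 1, the bound**; J. London Math.
  Soc. 37, p. 10; wording of [deSeguinsPazzis2015Flanders, Thm. 1]: "Let `𝒱` be a rank-`r̄` linear
  subspace of `Mat_{n,p}(𝔽)`. Then `dim 𝒱 ≤ nr`"), square case `p = n`: if every member of a
  linear subspace `W ≤ M_n(ℂ)` has rank `≤ rank A₀` for some `A₀ ∈ W`, then
  `dim W ≤ rank A₀ · n`.
* `finrank_le_of_forall_det_eq_zero` (**Dieudonné 1949**, Arch. Math. 1, pp. 282–287 — the case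
  `r = n - 1`: "subspaces of singular matrices", [deSeguinsPazzis2015Flanders, p. 3]): a linear
  subspace of `M_n(ℂ)` consisting of singular matrices has dimension `≤ n(n-1)`.
* `exists_mulVec_eq_zero_or_vecMul_eq_zero_of_finrank_eq` (**Dieudonné 1949 / Flanders 1962, the
  equality case**: "if equality holds then either `𝒱` is equivalent to `ℛ(0,r)`, or `n = p` and `𝒱`
  is equivalent to `ℛ(r,0)`" [deSeguinsPazzis2015Flanders, Thm. 1], at `r = n-1`: all matrices
  with a given nonzero vector in the kernel, resp. in the left kernel): if such a space has
  dimension exactly `n(n-1)` then its members have a common nonzero kernel vector or a common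
  nonzero left-kernel vector.

TODO(general form): any field with more than `r` elements (Flanders), any field (Meshulam 1985),
rectangular `n × p` matrices and general `r` for the equality case; here `ℂ` and square matrices,
which is what the Makam–Wigderson application needs.

## Proof (Flanders' argument, the "vanishing minors" steps done by continuity)

Let `A₀ ∈ W` have maximal rank `r` and change bases so that `A₀ = J = [[1,0],[0,0]]` on
`Fin r ⊕ Fin s` (`Flanders.exists_bases_toMatrix_eq_J`). For `B ∈ W` and all `t`,
`rank (J + tB) ≤ r`; hence anything lying in `range (J + tB)` for every `t ≠ 0` lies in `range J`,
because adjoining it to a basis of `range J` moved along `J uᵢ + tB uᵢ` gives `r + 1` dependent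
vectors for `t ≠ 0`, and dependence is a CLOSED condition in `t` (Mathlib
`isOpen_setOf_linearIndependent`) while `{t ≠ 0}` is dense (`Flanders.mem_range_of_forall_ne_zero`).
Applied to `B e_j` and then to `B u` with `J u = B e_j` this yields the block conditions
`B₂₂ = 0` and `B₂₁ B₁₂ = 0` (`Flanders.toBlocks₂₂_eq_zero`, `Flanders.toBlocks₂₁_mul_toBlocks₁₂_eq_zero`),
and by polarisation `B₂₁ B'₁₂ + B'₂₁ B₁₂ = 0`. Counting: `B ↦ (B₁₁, (col_j B₁₂, row_j B₂₁)_j)` is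
injective on `W`, and for each `j` the pairs `(col_j B₁₂, row_j B₂₁)` form a subspace of
`ℂ^r × ℂ^r` on which the split form `d·c' + d'·c` vanishes, hence of dimension `≤ r`
(`Flanders.finrank_le_of_isotropic`: the second components of the pairs `(0,d)` annihilate the first
projection). So `dim W ≤ r² + s r = r n`. Equality with `s = 1` forces the pair space `P` to have
dimension `r` and `W = {[[M, c], [d, 0]] : M arbitrary, (c,d) ∈ P}`; a pair with `c ≠ 0 ≠ d`
would give an invertible member (`Flanders.exists_det_ne_zero`, `M = 1 - E_{ji}`), so `P` lies in
one coordinate axis: last column zero (common kernel vector) or last row zero (common cokernel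
vector), transported back along the bases.

## References

* [Dieudonne1948] J. Dieudonné, *Sur une généralisation du groupe orthogonal à quatre variables*,
  Arch. Math. 1 (1948/49) 282–287.
* [Flanders1962] H. Flanders, *On spaces of linear transformations with bounded rank*, J. London
  Math. Soc. 37 (1962) 10–16, Thm. 1.
* [deSeguinsPazzis2015Flanders] C. de Seguins Pazzis, *The Flanders theorem over division rings*,
  Linear Algebra Appl. (2016) = arXiv:1504.01986, Thm. 1 and p. 3 (history; held text
  `paper:arxiv-1504.01986`, p0003.txt:L37–L46).
-/

noncomputable section

open Module LinearMap Matrix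

namespace Literature.LinearAlgebra

namespace Flanders

/-! ### The continuity lemma -/

section Continuity

variable {V : Type*} [NormedAddCommGroup V] [NormedSpace ℂ V] [FiniteDimensional ℂ V]

/-- **Flanders' minors argument, done by continuity.** If `A + tB` has rank at most `rank A` for
every `t`, and `x` lies in the range of `A + tB` for every `t ≠ 0`, then `x` lies in the range of
`A`: adjoin `x` to a basis `A u₁, …, A u_r` of `range A`; for `t ≠ 0` the `r + 1` vectors
`A uᵢ + t B uᵢ`, `x` lie in `range (A + tB)` and are therefore dependent; dependence is a closed
condition in `t`, so it persists at `t = 0`. [folklore] -/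
private theorem mem_range_of_forall_ne_zero (A B : V →ₗ[ℂ] V)
    (hr : ∀ t : ℂ, finrank ℂ (range (A + t • B)) ≤ finrank ℂ (range A)) {x : V}
    (hx : ∀ t : ℂ, t ≠ 0 → x ∈ range (A + t • B)) : x ∈ range A := by
  set r := finrank ℂ (range A) with hr_def
  let b : Basis (Fin r) ℂ (range A) := Module.finBasisOfFinrankEq ℂ (range A) rfl
  -- preimages `u i` of the basis vectors
  have hu : ∀ i : Fin r, ∃ u : V, A u = (b i : V) := fun i => LinearMap.mem_range.1 (b i).2
  choose u hu using hu
  -- the family `t ↦ (x, A u₁ + t B u₁, …)`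
  let f : ℂ → Fin (r + 1) → V := fun t => Fin.cons x fun i => (b i : V) + t • B (u i)
  have hf : Continuous f := by
    refine continuous_pi fun j => ?_
    refine Fin.cases ?_ (fun i => ?_) j
    · simp only [f, Fin.cons_zero]
      exact continuous_const
    · simp only [f, Fin.cons_succ]
      exact continuous_const.add (continuous_id.smul continuous_const)
  -- linear independence of the basis vectors in `V`
  have hb : LinearIndependent ℂ fun i : Fin r => (b i : V) :=
    b.linearIndependent.map' (range A).subtype (Submodule.ker_subtype _)
  -- for `t ≠ 0` the family is dependent
  have hdep : ∀ t : ℂ, t ≠ 0 → ¬ LinearIndependent ℂ (f t) := by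
    intro t ht hli
    have hmem : ∀ j, f t j ∈ range (A + t • B) := by
      intro j
      refine Fin.cases ?_ (fun i => ?_) j
      · simpa only [f, Fin.cons_zero] using hx t ht
      · simp only [f, Fin.cons_succ]
        exact LinearMap.mem_range.2 ⟨u i, by simp [hu i]⟩
    have hspan : Submodule.span ℂ (Set.range (f t)) ≤ range (A + t • B) :=
      Submodule.span_le.2 (Set.range_subset_iff.2 hmem)
    have h1 : finrank ℂ (Submodule.span ℂ (Set.range (f t))) = r + 1 := by
      rw [finrank_span_eq_card hli, Fintype.card_fin]
    have h2 := Submodule.finrank_mono hspan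
    have h3 := hr t
    omega
  -- dependence is closed, `{t ≠ 0}` is dense, hence dependence at `t = 0`
  have hclosed : IsClosed {t : ℂ | ¬ LinearIndependent ℂ (f t)} := by
    have : IsOpen (f ⁻¹' {g : Fin (r + 1) → V | LinearIndependent ℂ g}) :=
      isOpen_setOf_linearIndependent.preimage hf
    simpa only [Set.preimage_setOf_eq, ← Set.compl_setOf, isClosed_compl_iff] using this
  have hdense : Dense {t : ℂ | ¬ LinearIndependent ℂ (f t)} :=
    (dense_compl_singleton (0 : ℂ)).mono fun t ht => hdep t ht
  have h0 : ¬ LinearIndependent ℂ (f 0) := by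
    have : (0 : ℂ) ∈ {t : ℂ | ¬ LinearIndependent ℂ (f t)} := by
      rw [← hclosed.closure_eq, hdense.closure_eq]; trivial
    exact this
  have hf0 : f 0 = Fin.cons x fun i => (b i : V) := by
    funext j
    refine Fin.cases ?_ (fun i => ?_) j
    · simp [f]
    · simp [f]
  rw [hf0, linearIndependent_finCons] at h0
  have hxspan : x ∈ Submodule.span ℂ (Set.range fun i : Fin r => (b i : V)) := by
    by_contra hxs
    exact h0 ⟨hb, hxs⟩
  refine (Submodule.span_le.2 ?_ : Submodule.span ℂ (Set.range fun i : Fin r => (b i : V)) ≤ range A)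
    hxspan
  rintro _ ⟨i, rfl⟩
  exact (b i).2

end Continuity

/-! ### Block structure along a maximal-rank element in normal form -/

section Blocks

variable {r s : ℕ}

/-- The normal form `J = [[1, 0], [0, 0]]` of a rank-`r` matrix, on `Fin r ⊕ Fin s`. [folklore] -/
abbrev J (r s : ℕ) : Matrix (Fin r ⊕ Fin s) (Fin r ⊕ Fin s) ℂ := fromBlocks 1 0 0 0

/-- `J v = (v₁, 0)`. [folklore] -/
private theorem J_mulVec (v : Fin r ⊕ Fin s → ℂ) : J r s *ᵥ v = Sum.elim (v ∘ Sum.inl) 0 := by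
  rw [J, fromBlocks_mulVec]
  simp

/-- `range J = {x | x₂ = 0}`. [folklore] -/
private theorem mem_range_toLin'_J {x : Fin r ⊕ Fin s → ℂ} :
    x ∈ range (Matrix.toLin' (J r s)) ↔ ∀ j, x (Sum.inr j) = 0 := by
  constructor
  · rintro ⟨v, rfl⟩ j
    rw [Matrix.toLin'_apply, J_mulVec]
    rfl
  · intro hx
    refine ⟨x, ?_⟩
    rw [Matrix.toLin'_apply, J_mulVec]
    funext a
    rcases a with i | j
    · rfl
    · exact (hx j).symm

/-- The rank of a square matrix is the dimension of the range of `toLin'`. [folklore] -/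
private theorem rank_eq_finrank_range_toLin' {m : Type*} [Fintype m] [DecidableEq m]
    (M : Matrix m m ℂ) : M.rank = finrank ℂ (range (Matrix.toLin' M)) := by
  rw [Matrix.toLin'_apply']
  rfl

variable (W : Submodule ℂ (Matrix (Fin r ⊕ Fin s) (Fin r ⊕ Fin s) ℂ))

/-- The key inclusion: along a max-rank `J ∈ W`, anything that lies in `range (J + tB)` for all
`t ≠ 0` lies in `range J`. [cite: Flanders1962, Thm. 1 (proof)] -/
private theorem mem_range_J (hJ : J r s ∈ W) (hmax : ∀ B ∈ W, B.rank ≤ (J r s).rank) {B}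
    (hB : B ∈ W) {x : Fin r ⊕ Fin s → ℂ}
    (hx : ∀ t : ℂ, t ≠ 0 → ∃ v, (J r s + t • B) *ᵥ v = x) : ∀ j, x (Sum.inr j) = 0 := by
  rw [← mem_range_toLin'_J]
  refine mem_range_of_forall_ne_zero (Matrix.toLin' (J r s)) (Matrix.toLin' B) (fun t => ?_)
    (fun t ht => ?_)
  · rw [← map_smul, ← map_add, ← rank_eq_finrank_range_toLin', ← rank_eq_finrank_range_toLin']
    exact hmax _ (W.add_mem hJ (W.smul_mem t hB))
  · obtain ⟨v, hv⟩ := hx t ht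
    refine ⟨v, ?_⟩
    rw [← map_smul, ← map_add, Matrix.toLin'_apply, hv]

/-- `B₂₂ = 0` for every `B ∈ W`. [cite: Flanders1962, Thm. 1 (proof)] -/
private theorem toBlocks₂₂_eq_zero (hJ : J r s ∈ W) (hmax : ∀ B ∈ W, B.rank ≤ (J r s).rank) {B}
    (hB : B ∈ W) : B.toBlocks₂₂ = 0 := by
  ext i j
  -- `x = B e_{inr j} = (J + tB)(t⁻¹ e_{inr j})`
  have hx : ∀ t : ℂ, t ≠ 0 → ∃ v, (J r s + t • B) *ᵥ v = B *ᵥ Pi.single (Sum.inr j) 1 := by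
    intro t ht
    refine ⟨t⁻¹ • Pi.single (Sum.inr j) 1, ?_⟩
    rw [add_mulVec, smul_mulVec, mulVec_smul, mulVec_smul, J_mulVec, smul_smul,
      mul_inv_cancel₀ ht, one_smul]
    have : (Pi.single (Sum.inr j) (1 : ℂ) : Fin r ⊕ Fin s → ℂ) ∘ Sum.inl = 0 := by
      funext i; simp
    rw [this]
    simp
  have := mem_range_J W hJ hmax hB hx i
  simpa [toBlocks₂₂, mulVec, dotProduct, Pi.single_apply] using this

/-- `B₂₁ B₁₂ = 0` for every `B ∈ W`. [cite: Flanders1962, Thm. 1 (proof)] -/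
private theorem toBlocks₂₁_mul_toBlocks₁₂_eq_zero (hJ : J r s ∈ W)
    (hmax : ∀ B ∈ W, B.rank ≤ (J r s).rank) {B} (hB : B ∈ W) :
    B.toBlocks₂₁ * B.toBlocks₁₂ = 0 := by
  have h22 := toBlocks₂₂_eq_zero W hJ hmax hB
  ext i j
  -- `v = e_{inr j}`, `u = (B₁₂ eⱼ ; 0)` satisfies `J u = B v`; then `B u ∈ range J`.
  set v : Fin r ⊕ Fin s → ℂ := Pi.single (Sum.inr j) 1 with hv
  set u : Fin r ⊕ Fin s → ℂ := Sum.elim (fun k => B (Sum.inl k) (Sum.inr j)) 0 with hu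
  have hBv : B *ᵥ v = u := by
    funext a
    rcases a with k | k
    · simp [hu, hv, mulVec, dotProduct, Pi.single_apply]
    · have := congrFun (congrFun h22 k) j
      simpa [hu, hv, mulVec, dotProduct, Pi.single_apply, toBlocks₂₂] using this
  have hJu : J r s *ᵥ u = u := by
    rw [J_mulVec]; funext a; rcases a with k | k <;> simp [hu]
  have hJv : J r s *ᵥ v = 0 := by
    rw [J_mulVec]
    have : v ∘ Sum.inl = 0 := by funext k; simp [hv]
    rw [this]; funext a; rcases a with k | k <;> simp
  have hx : ∀ t : ℂ, t ≠ 0 → ∃ w, (J r s + t • B) *ᵥ w = B *ᵥ u := by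
    intro t ht
    refine ⟨(-(t⁻¹) ^ 2) • (v - t • u), ?_⟩
    rw [mulVec_smul, add_mulVec, smul_mulVec, mulVec_sub, mulVec_sub, mulVec_smul,
      mulVec_smul, hJv, hJu, hBv, zero_sub]
    -- `-(t⁻²) • (-(t u) + t • (u - t • B u)) = B u`
    ext a
    simp only [Pi.smul_apply, Pi.add_apply, Pi.neg_apply, Pi.sub_apply, smul_eq_mul]
    field_simp
    ring
  have := mem_range_J W hJ hmax hB hx i
  simpa [Matrix.mul_apply, toBlocks₂₁, toBlocks₁₂, mulVec, dotProduct, hu] using this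

/-- Polarisation: `B₂₁ B'₁₂ + B'₂₁ B₁₂ = 0`. [cite: Flanders1962, Thm. 1 (proof)] -/
private theorem polar (hJ : J r s ∈ W) (hmax : ∀ B ∈ W, B.rank ≤ (J r s).rank) {B B'} (hB : B ∈ W)
    (hB' : B' ∈ W) : B.toBlocks₂₁ * B'.toBlocks₁₂ + B'.toBlocks₂₁ * B.toBlocks₁₂ = 0 := by
  have h1 := toBlocks₂₁_mul_toBlocks₁₂_eq_zero W hJ hmax hB
  have h2 := toBlocks₂₁_mul_toBlocks₁₂_eq_zero W hJ hmax hB'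
  have h3 := toBlocks₂₁_mul_toBlocks₁₂_eq_zero W hJ hmax (W.add_mem hB hB')
  have e21 : (B + B').toBlocks₂₁ = B.toBlocks₂₁ + B'.toBlocks₂₁ := rfl
  have e12 : (B + B').toBlocks₁₂ = B.toBlocks₁₂ + B'.toBlocks₁₂ := rfl
  rw [e21, e12, Matrix.add_mul, Matrix.mul_add, Matrix.mul_add, h1, h2, zero_add, add_zero] at h3
  exact h3

/-! ### The isotropic-pairs lemma -/

/-- Membership in the dot-product annihilator `U^⊥ = {y | ∀ u ∈ U, y · u = 0}`. [folklore] -/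
private theorem mem_dotAnnihilator {ι : Type*} [Fintype ι] [DecidableEq ι]
    (U : Submodule ℂ (ι → ℂ)) (y : ι → ℂ) :
    y ∈ U.dualAnnihilator.comap ((dotProductEquiv ℂ ι : (ι → ℂ) ≃ₗ[ℂ] _) :
        (ι → ℂ) →ₗ[ℂ] Module.Dual ℂ (ι → ℂ)) ↔ ∀ u ∈ U, y ⬝ᵥ u = 0 := by
  simp [Submodule.mem_dualAnnihilator]

/-- `dim U^⊥ + dim U = #ι` for the dot-product annihilator. [folklore] -/
private theorem finrank_dotAnnihilator {ι : Type*} [Fintype ι] [DecidableEq ι]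
    (U : Submodule ℂ (ι → ℂ)) :
    finrank ℂ (U.dualAnnihilator.comap ((dotProductEquiv ℂ ι : (ι → ℂ) ≃ₗ[ℂ] _) :
        (ι → ℂ) →ₗ[ℂ] Module.Dual ℂ (ι → ℂ))) + finrank ℂ U = Fintype.card ι := by
  rw [Submodule.comap_equiv_eq_map_symm, LinearEquiv.finrank_map_eq, add_comm,
    Subspace.finrank_add_finrank_dualAnnihilator_eq, finrank_fintype_fun_eq_card]

/-- **Isotropic pairs.** A subspace `P` of `ℂ^r × ℂ^r` on which the split symmetric form
`⟨(c,d),(c',d')⟩ = d·c' + d'·c` vanishes identically has dimension at most `r`: the second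
components of the pairs `(0, d) ∈ P` annihilate the first projection of `P`. [folklore] -/
private theorem finrank_le_of_isotropic (P : Submodule ℂ ((Fin r → ℂ) × (Fin r → ℂ)))
    (h : ∀ p ∈ P, ∀ q ∈ P, p.2 ⬝ᵥ q.1 + q.2 ⬝ᵥ p.1 = 0) : finrank ℂ P ≤ r := by
  classical
  set f : P →ₗ[ℂ] (Fin r → ℂ) := (LinearMap.fst ℂ _ _).domRestrict P with hf
  have hsum := LinearMap.finrank_range_add_finrank_ker f
  have hker : ∀ p : LinearMap.ker f, ((p : P) : (Fin r → ℂ) × (Fin r → ℂ)).1 = 0 := by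
    intro p
    have hp := p.2
    rw [LinearMap.mem_ker] at hp
    exact hp
  set g : LinearMap.ker f →ₗ[ℂ] (Fin r → ℂ) :=
    (LinearMap.snd ℂ _ _) ∘ₗ P.subtype ∘ₗ (LinearMap.ker f).subtype with hg
  have hg_apply : ∀ p, g p = ((p : P) : (Fin r → ℂ) × (Fin r → ℂ)).2 := fun p => rfl
  have hg_inj : Function.Injective g := by
    intro p q hpq
    apply Subtype.ext; apply Subtype.ext
    rw [hg_apply, hg_apply] at hpq
    exact Prod.ext (by rw [hker p, hker q]) hpq
  set Ann := (LinearMap.range f).dualAnnihilator.comap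
    ((dotProductEquiv ℂ (Fin r) : (Fin r → ℂ) ≃ₗ[ℂ] _) :
      (Fin r → ℂ) →ₗ[ℂ] Module.Dual ℂ (Fin r → ℂ)) with hAnn
  have hg_le : LinearMap.range g ≤ Ann := by
    rintro _ ⟨p, rfl⟩
    rw [hAnn, mem_dotAnnihilator]
    rintro _ ⟨q, rfl⟩
    have := h _ (p : P).2 _ q.2
    rw [hker p, dotProduct_zero, add_zero] at this
    rw [hg_apply]
    exact this
  have h1 : finrank ℂ (LinearMap.ker f) ≤ finrank ℂ Ann := by
    rw [← LinearMap.finrank_range_of_inj hg_inj]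
    exact Submodule.finrank_mono hg_le
  have h2 := finrank_dotAnnihilator (LinearMap.range f)
  rw [← hAnn, Fintype.card_fin] at h2
  omega

/-! ### The count `dim W ≤ r (r + s)` -/

/-- Column `j` of `B₁₂` and row `j` of `B₂₁`, as a pair in `ℂ^r × ℂ^r` (linear in `B`;
bookkeeping). [folklore] -/
def colRow (j : Fin s) :
    Matrix (Fin r ⊕ Fin s) (Fin r ⊕ Fin s) ℂ →ₗ[ℂ] (Fin r → ℂ) × (Fin r → ℂ) where
  toFun B := (fun i => B (Sum.inl i) (Sum.inr j), fun i => B (Sum.inr j) (Sum.inl i))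
  map_add' _ _ := rfl
  map_smul' _ _ := rfl

/-- The upper-left block `B₁₁`, linear in `B` (bookkeeping). [folklore] -/
def blocks₁₁ : Matrix (Fin r ⊕ Fin s) (Fin r ⊕ Fin s) ℂ →ₗ[ℂ] Matrix (Fin r) (Fin r) ℂ where
  toFun B := B.toBlocks₁₁
  map_add' _ _ := rfl
  map_smul' _ _ := rfl

/-- The pairs `(col_j B₁₂, row_j B₂₁)`, `B ∈ W`, are isotropic for the split form (entry `(j,j)`
of the polarised identity `B₂₁ B'₁₂ + B'₂₁ B₁₂ = 0`). [cite: Flanders1962, Thm. 1 (proof)] -/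
theorem isotropic_colRow (hJ : J r s ∈ W) (hmax : ∀ B ∈ W, B.rank ≤ (J r s).rank) (j : Fin s) :
    ∀ p ∈ W.map (colRow j), ∀ q ∈ W.map (colRow j), p.2 ⬝ᵥ q.1 + q.2 ⬝ᵥ p.1 = 0 := by
  rintro _ ⟨B, hB, rfl⟩ _ ⟨B', hB', rfl⟩
  have := congrFun (congrFun (polar W hJ hmax hB hB') j) j
  simpa [Matrix.add_apply, Matrix.mul_apply, toBlocks₂₁, toBlocks₁₂, colRow, dotProduct] using this

/-- A member of `W` is determined by its upper-left block and its pairs `(col_j B₁₂, row_j B₂₁)`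
(because `B₂₂ = 0`). [cite: Flanders1962, Thm. 1 (proof)] -/
private theorem eq_of_blocks (hJ : J r s ∈ W) (hmax : ∀ B ∈ W, B.rank ≤ (J r s).rank) {B B'}
    (hB : B ∈ W) (hB' : B' ∈ W) (h11 : B.toBlocks₁₁ = B'.toBlocks₁₁)
    (hcr : ∀ j, colRow j B = colRow j B') : B = B' := by
  have h22 := toBlocks₂₂_eq_zero W hJ hmax hB
  have h22' := toBlocks₂₂_eq_zero W hJ hmax hB'
  ext a b
  rcases a with i | j <;> rcases b with i' | j'
  · exact congrFun (congrFun h11 i) i'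
  · have := congrArg (fun p : (Fin r → ℂ) × (Fin r → ℂ) => p.1 i) (hcr j')
    simpa [colRow] using this
  · have := congrArg (fun p : (Fin r → ℂ) × (Fin r → ℂ) => p.2 i') (hcr j)
    simpa [colRow] using this
  · have e1 := congrFun (congrFun h22 j) j'
    have e2 := congrFun (congrFun h22' j) j'
    simp only [toBlocks₂₂, of_apply, Matrix.zero_apply] at e1 e2
    rw [e1, e2]

/-- **Flanders' count in normal form**: `dim W ≤ r² + s r` (`= r n`): `B ↦ (B₁₁, (col_j B₁₂,
row_j B₂₁)_j)` is injective on `W` and each pair space has dimension `≤ r`.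
[cite: Flanders1962, Thm. 1 (proof)] -/
theorem finrank_le (hJ : J r s ∈ W) (hmax : ∀ B ∈ W, B.rank ≤ (J r s).rank) :
    finrank ℂ W ≤ r * r + s * r := by
  classical
  let P : Fin s → Submodule ℂ ((Fin r → ℂ) × (Fin r → ℂ)) := fun j => W.map (colRow j)
  have hP : ∀ j, finrank ℂ (P j) ≤ r := fun j =>
    finrank_le_of_isotropic (P j) (isotropic_colRow W hJ hmax j)
  let Φ : W →ₗ[ℂ] Matrix (Fin r) (Fin r) ℂ × (Π j, P j) :=
    LinearMap.prod (blocks₁₁ ∘ₗ W.subtype)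
      (LinearMap.pi fun j => ((colRow j) ∘ₗ W.subtype).codRestrict (P j)
        fun B => Submodule.mem_map_of_mem B.2)
  have hΦ : Function.Injective Φ := by
    intro B B' hBB'
    apply Subtype.ext
    have h11 : B.1.toBlocks₁₁ = B'.1.toBlocks₁₁ := congrArg Prod.fst hBB'
    have hcr : ∀ j, colRow j B.1 = colRow j B'.1 := fun j => by
      have := congrFun (congrArg Prod.snd hBB') j
      exact congrArg Subtype.val this
    exact eq_of_blocks W hJ hmax B.2 B'.2 h11 hcr
  calc finrank ℂ W ≤ finrank ℂ (Matrix (Fin r) (Fin r) ℂ × (Π j, P j)) :=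
        LinearMap.finrank_le_finrank_of_injective hΦ
    _ = r * r + ∑ j, finrank ℂ (P j) := by
        rw [Module.finrank_prod, Module.finrank_pi_fintype, Module.finrank_matrix]
        simp
    _ ≤ r * r + ∑ _j : Fin s, r := by gcongr with j; exact hP j
    _ = r * r + s * r := by simp

end Blocks

/-! ### The equality case (`s = 1`): common kernel or common cokernel -/

section EqualityCase

variable {r : ℕ}

/-- A subspace contained in the union of the two coordinate axes of a product lies in one of them.
[folklore] -/
private theorem fst_eq_zero_or_snd_eq_zero {E F : Type*} [AddCommGroup E] [Module ℂ E] [AddCommGroup F]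
    [Module ℂ F] (P : Submodule ℂ (E × F)) (h : ∀ p ∈ P, p.1 = 0 ∨ p.2 = 0) :
    (∀ p ∈ P, p.1 = 0) ∨ (∀ p ∈ P, p.2 = 0) := by
  by_contra hcon
  rw [not_or, not_forall, not_forall] at hcon
  obtain ⟨⟨p, hp⟩, ⟨q, hq⟩⟩ := hcon
  rw [Classical.not_imp] at hp hq
  have hp2 : p.2 = 0 := (h p hp.1).resolve_left hp.2
  have hq1 : q.1 = 0 := (h q hq.1).resolve_right hq.2
  rcases h (p + q) (P.add_mem hp.1 hq.1) with h1 | h2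
  · exact hp.2 (by simpa [hq1] using h1)
  · exact hq.2 (by simpa [hp2] using h2)

/-- With an isotropic pair `(c, d)`, `c ≠ 0`, `d ≠ 0`, `d · c = 0`, some `[[M, c], [d, 0]]` is
invertible: take `M = 1 - E_{ji}` with `cᵢ ≠ 0 ≠ dⱼ`, `i ≠ j`. [folklore] -/
private theorem exists_det_ne_zero {c d : Fin r → ℂ} (hc : c ≠ 0) (hd : d ≠ 0) (hdc : d ⬝ᵥ c = 0) :
    ∃ M : Matrix (Fin r) (Fin r) ℂ,
      (fromBlocks M (Matrix.of fun i (_ : Fin 1) => c i) (Matrix.of fun (_ : Fin 1) i => d i)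
        (0 : Matrix (Fin 1) (Fin 1) ℂ)).det ≠ 0 := by
  classical
  obtain ⟨j, hj⟩ : ∃ j, d j ≠ 0 := Function.ne_iff.1 hd
  obtain ⟨i, hij, hi⟩ : ∃ i, i ≠ j ∧ c i ≠ 0 := by
    by_contra h
    simp only [not_exists, not_and, not_not] at h
    have hcj : c j ≠ 0 := by
      intro hcj
      apply hc
      funext k
      by_cases hk : k = j
      · rw [hk, hcj]; rfl
      · exact h k hk
    have : d ⬝ᵥ c = d j * c j := by
      rw [dotProduct]
      exact Finset.sum_eq_single j (fun k _ hk => by rw [h k hk, mul_zero])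
        (fun h' => absurd (Finset.mem_univ j) h')
    exact mul_ne_zero hj hcj (this ▸ hdc)
  set C : Matrix (Fin r) (Fin 1) ℂ := Matrix.of fun i (_ : Fin 1) => c i with hC
  set D : Matrix (Fin 1) (Fin r) ℂ := Matrix.of fun (_ : Fin 1) i => d i with hD
  set N : Matrix (Fin r) (Fin r) ℂ := transvection j i 1 with hN
  refine ⟨transvection j i (-1), ?_⟩
  have hNM : N * transvection j i (-1) = 1 := by
    rw [hN, transvection_mul_transvection_same j i hij.symm, add_neg_cancel, transvection_zero]
  have hfac : fromBlocks (transvection j i (-1)) C D (0 : Matrix (Fin 1) (Fin 1) ℂ) =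
      fromBlocks 1 C (D * N) 0 * fromBlocks (transvection j i (-1)) 0 0 1 := by
    rw [fromBlocks_multiply]
    simp [Matrix.mul_assoc, hNM]
  rw [hfac, det_mul, det_fromBlocks_one₁₁, det_fromBlocks_zero₂₁, det_one, mul_one,
    det_transvection_of_ne j i hij.symm, mul_one, zero_sub, det_neg, det_fin_one]
  -- `(D N C)₀₀ = d · c + dⱼ cᵢ = dⱼ cᵢ`
  have hentry : (D * N * C) 0 0 = d j * c i := by
    have h1 : (D * N * C) 0 0 = ∑ b, (D * N) 0 b * c b := by
      simp [Matrix.mul_apply, hC]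
    have h2 : ∀ b, (D * N) 0 b = d b + (if b = i then d j else 0) := by
      intro b
      rw [hN, Matrix.transvection, Matrix.mul_add, Matrix.mul_one, Matrix.add_apply]
      have hDb : D 0 b = d b := by simp [hD]
      rw [hDb]
      congr 1
      rw [hD, Matrix.mul_apply]
      simp only [of_apply, Matrix.single_apply]
      rw [Finset.sum_eq_single j]
      · by_cases hb : b = i
        · subst hb; simp
        · simp [Ne.symm hb, hb]
      · intro a _ ha; simp [Ne.symm ha]
      · intro h; exact absurd (Finset.mem_univ j) h
    rw [h1]
    simp_rw [h2, add_mul, Finset.sum_add_distrib, ite_mul, zero_mul, Finset.sum_ite_eq',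
      Finset.mem_univ, if_true]
    have : ∑ b, d b * c b = d ⬝ᵥ c := rfl
    rw [this, hdc, zero_add]
  rw [hentry]
  simp [hj, hi]

/-- Square matrices of full rank are units. [folklore] -/
private theorem isUnit_of_rank_eq {m : Type*} [Fintype m] [DecidableEq m] {A : Matrix m m ℂ}
    (h : A.rank = Fintype.card m) : IsUnit A := by
  rw [← mulVec_surjective_iff_isUnit]
  have htop : LinearMap.range A.mulVecLin = ⊤ := by
    apply Submodule.eq_top_of_finrank_eq
    rw [Module.finrank_pi, ← h]
    rfl
  intro y
  obtain ⟨x, hx⟩ := LinearMap.range_eq_top.1 htop y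
  exact ⟨x, hx⟩

/-- `det J = 0` when the zero block is `1 × 1`. [folklore] -/
private theorem det_J_one : (J r 1).det = 0 := by
  rw [J, det_fromBlocks_zero₂₁, det_fin_one]
  simp

/-- **Equality case in normal form.** If `dim W = r(r+1)` (`s = 1`), then either the last column
of every member of `W` vanishes or the last row does. [cite: Flanders1962, Thm. 1 (proof)] -/
private theorem col_eq_zero_or_row_eq_zero (W : Submodule ℂ (Matrix (Fin r ⊕ Fin 1) (Fin r ⊕ Fin 1) ℂ))
    (hJ : J r 1 ∈ W) (hmax : ∀ B ∈ W, B.rank ≤ (J r 1).rank)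
    (hdim : finrank ℂ W = r * (r + 1)) :
    (∀ B ∈ W, ∀ a, B a (Sum.inr 0) = 0) ∨ (∀ B ∈ W, ∀ b, B (Sum.inr 0) b = 0) := by
  classical
  set P : Submodule ℂ ((Fin r → ℂ) × (Fin r → ℂ)) := W.map (colRow 0) with hPdef
  have hPiso := isotropic_colRow W hJ hmax 0
  have hP : finrank ℂ P ≤ r := finrank_le_of_isotropic P hPiso
  let Φ : W →ₗ[ℂ] Matrix (Fin r) (Fin r) ℂ × P :=
    LinearMap.prod (blocks₁₁ ∘ₗ W.subtype)
      (((colRow 0) ∘ₗ W.subtype).codRestrict P fun B => Submodule.mem_map_of_mem B.2)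
  have hΦ : Function.Injective Φ := by
    intro B B' hBB'
    apply Subtype.ext
    have h11 : B.1.toBlocks₁₁ = B'.1.toBlocks₁₁ := congrArg Prod.fst hBB'
    have hcr0 : colRow 0 B.1 = colRow 0 B'.1 :=
      congrArg Subtype.val (congrArg Prod.snd hBB')
    refine eq_of_blocks W hJ hmax B.2 B'.2 h11 fun j => ?_
    rw [Fin.fin_one_eq_zero j]; exact hcr0
  have hcod : finrank ℂ (Matrix (Fin r) (Fin r) ℂ × P) = r * r + finrank ℂ P := by
    rw [Module.finrank_prod, Module.finrank_matrix]; simp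
  have hle := LinearMap.finrank_le_finrank_of_injective hΦ
  have heq : finrank ℂ W = finrank ℂ (Matrix (Fin r) (Fin r) ℂ × P) := by
    rw [hcod] at hle ⊢; rw [hdim] at hle ⊢; nlinarith
  have hsurj : Function.Surjective Φ :=
    (LinearMap.injective_iff_surjective_of_finrank_eq_finrank heq).1 hΦ
  -- every pair in `P` has a zero component
  have hzero : ∀ p ∈ P, p.1 = 0 ∨ p.2 = 0 := by
    intro p hp
    by_contra hne
    rw [not_or] at hne
    have hdc : p.2 ⬝ᵥ p.1 = 0 := by
      have := hPiso p hp p hp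
      rw [← two_mul, mul_eq_zero] at this
      exact this.resolve_left two_ne_zero
    obtain ⟨M, hM⟩ := exists_det_ne_zero hne.1 hne.2 hdc
    obtain ⟨B, hB⟩ := hsurj (M, ⟨p, hp⟩)
    have h11 : B.1.toBlocks₁₁ = M := congrArg Prod.fst hB
    have hcr : colRow 0 B.1 = p := congrArg Subtype.val (congrArg Prod.snd hB)
    have h22 := toBlocks₂₂_eq_zero W hJ hmax B.2
    have hBeq : B.1 = fromBlocks M (Matrix.of fun i (_ : Fin 1) => p.1 i)
        (Matrix.of fun (_ : Fin 1) i => p.2 i) 0 := by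
      rw [← fromBlocks_toBlocks B.1, h11, h22]
      congr 1
      · ext i k
        rw [Fin.fin_one_eq_zero k]
        have := congrArg (fun q : (Fin r → ℂ) × (Fin r → ℂ) => q.1 i) hcr
        simpa [colRow, toBlocks₁₂] using this
      · ext k i
        rw [Fin.fin_one_eq_zero k]
        have := congrArg (fun q : (Fin r → ℂ) × (Fin r → ℂ) => q.2 i) hcr
        simpa [colRow, toBlocks₂₁] using this
    have hunit : IsUnit B.1 := by
      rw [Matrix.isUnit_iff_isUnit_det, hBeq]; exact isUnit_iff_ne_zero.2 hM
    have hrank := hmax _ B.2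
    rw [rank_of_isUnit _ hunit] at hrank
    have hJrank : (J r 1).rank = Fintype.card (Fin r ⊕ Fin 1) :=
      le_antisymm (rank_le_card_width _) hrank
    have := isUnit_of_rank_eq hJrank
    rw [Matrix.isUnit_iff_isUnit_det, det_J_one] at this
    exact not_isUnit_zero this
  rcases fst_eq_zero_or_snd_eq_zero P hzero with h1 | h2
  · left
    intro B hB a
    rcases a with i | k
    · have := congrFun (h1 _ (Submodule.mem_map_of_mem (f := colRow 0) hB)) i
      simpa [colRow] using this
    · rw [Fin.fin_one_eq_zero k]
      have := congrFun (congrFun (toBlocks₂₂_eq_zero W hJ hmax hB) 0) 0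
      simpa [toBlocks₂₂] using this
  · right
    intro B hB b
    rcases b with i | k
    · have := congrFun (h2 _ (Submodule.mem_map_of_mem (f := colRow 0) hB)) i
      simpa [colRow] using this
    · rw [Fin.fin_one_eq_zero k]
      have := congrFun (congrFun (toBlocks₂₂_eq_zero W hJ hmax hB) 0) 0
      simpa [toBlocks₂₂] using this

end EqualityCase

/-! ### Normal form of a maximal-rank element (change of bases) -/

section NormalForm

variable {n : ℕ}

/-- **Rank normal form by a change of bases.** For `A₀` of rank `r` and `r + s = n` there are bases
`𝔅₁, 𝔅₂` of `ℂⁿ` indexed by `Fin r ⊕ Fin s` in which `A₀` becomes `J = [[1,0],[0,0]]`: `𝔅₁` =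
(basis of a complement `C` of `ker A₀`) ⊔ (basis of `ker A₀`), `𝔅₂` = (its image under `A₀`) ⊔
(basis of a complement of `range A₀`). [folklore] -/
private theorem exists_bases_toMatrix_eq_J (A₀ : Matrix (Fin n) (Fin n) ℂ) {r s : ℕ} (hr : A₀.rank = r)
    (hrs : r + s = n) :
    ∃ 𝔅₁ 𝔅₂ : Basis (Fin r ⊕ Fin s) ℂ (Fin n → ℂ),
      LinearMap.toMatrix 𝔅₁ 𝔅₂ (Matrix.toLin' A₀) = J r s := by
  classical
  set f := Matrix.toLin' A₀ with hf
  set K := LinearMap.ker f with hK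
  set I := LinearMap.range f with hI
  have hIr : finrank ℂ I = r := by rw [hI, hf, ← rank_eq_finrank_range_toLin', hr]
  have hKs : finrank ℂ K = s := by
    have h1 := LinearMap.finrank_range_add_finrank_ker f
    rw [Module.finrank_fin_fun, ← hI, ← hK] at h1
    omega
  obtain ⟨C, hKC⟩ := K.exists_isCompl
  obtain ⟨D, hID⟩ := I.exists_isCompl
  have hCr : finrank ℂ C = r := by
    have h1 := Submodule.finrank_add_eq_of_isCompl hKC
    rw [Module.finrank_fin_fun] at h1; omega
  have hDs : finrank ℂ D = s := by
    have h1 := Submodule.finrank_add_eq_of_isCompl hID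
    rw [Module.finrank_fin_fun] at h1; omega
  let bC : Basis (Fin r) ℂ C := Module.finBasisOfFinrankEq ℂ C hCr
  let bK : Basis (Fin s) ℂ K := Module.finBasisOfFinrankEq ℂ K hKs
  let bD : Basis (Fin s) ℂ D := Module.finBasisOfFinrankEq ℂ D hDs
  -- `A₀` restricted to `C` is an isomorphism onto `I`
  let eCI : C ≃ₗ[ℂ] I := (Submodule.quotientEquivOfIsCompl K C hKC).symm ≪≫ₗ f.quotKerEquivRange
  have heCI : ∀ c : C, (eCI c : Fin n → ℂ) = f c := by
    intro c
    have h1 : (Submodule.quotientEquivOfIsCompl K C hKC).symm c = Submodule.Quotient.mk (c : Fin n → ℂ) := by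
      rw [LinearEquiv.symm_apply_eq, Submodule.quotientEquivOfIsCompl_apply_mk_right]
    simp only [eCI, LinearEquiv.trans_apply, h1]
    exact LinearMap.quotKerEquivRange_apply_mk f c
  let bI : Basis (Fin r) ℂ I := bC.map eCI
  let 𝔅₁ : Basis (Fin r ⊕ Fin s) ℂ (Fin n → ℂ) :=
    (bC.prod bK).map (Submodule.prodEquivOfIsCompl C K hKC.symm)
  let 𝔅₂ : Basis (Fin r ⊕ Fin s) ℂ (Fin n → ℂ) :=
    (bI.prod bD).map (Submodule.prodEquivOfIsCompl I D hID)
  have h𝔅₁l : ∀ i, 𝔅₁ (Sum.inl i) = (bC i : Fin n → ℂ) := fun i => by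
    simp [𝔅₁, Submodule.coe_prodEquivOfIsCompl']
  have h𝔅₁r : ∀ j, 𝔅₁ (Sum.inr j) = (bK j : Fin n → ℂ) := fun j => by
    simp [𝔅₁, Submodule.coe_prodEquivOfIsCompl']
  have h𝔅₂l : ∀ i, 𝔅₂ (Sum.inl i) = f (bC i) := fun i => by
    simp [𝔅₂, bI, Submodule.coe_prodEquivOfIsCompl', heCI]
  refine ⟨𝔅₁, 𝔅₂, ?_⟩
  ext a b
  rw [LinearMap.toMatrix_apply]
  rcases b with i | j
  · rw [h𝔅₁l, ← h𝔅₂l, 𝔅₂.repr_self]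
    rcases a with i' | j'
    · simp [J, fromBlocks_apply₁₁, Matrix.one_apply, Finsupp.single_apply, eq_comm]
    · simp [J, fromBlocks_apply₂₁]
  · have : f (𝔅₁ (Sum.inr j)) = 0 := by
      rw [h𝔅₁r]; exact (LinearMap.mem_ker).1 (bK j).2
    rw [this, map_zero]
    rcases a with i' | j'
    · simp [J, fromBlocks_apply₁₂]
    · simp [J, fromBlocks_apply₂₂]

/-- The change of bases `B ↦ [B]_{𝔅₁ 𝔅₂}` preserves the rank. [folklore] -/
private theorem rank_toMatrix_toLin' {ι : Type*} [Fintype ι] [DecidableEq ι] (𝔅₁ 𝔅₂ : Basis ι ℂ (Fin n → ℂ))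
    (B : Matrix (Fin n) (Fin n) ℂ) :
    (LinearMap.toMatrix 𝔅₁ 𝔅₂ (Matrix.toLin' B)).rank = B.rank := by
  rw [Matrix.rank_eq_finrank_range_toLin _ 𝔅₂ 𝔅₁, Matrix.toLin_toMatrix,
    rank_eq_finrank_range_toLin']

/-- Transfer of a common kernel vector back from coordinates. [folklore] -/
private theorem mulVec_eq_zero_of_col_eq_zero {ι : Type*} [Fintype ι] [DecidableEq ι]
    (𝔅₁ 𝔅₂ : Basis ι ℂ (Fin n → ℂ)) (B : Matrix (Fin n) (Fin n) ℂ) (b : ι)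
    (h : ∀ a, LinearMap.toMatrix 𝔅₁ 𝔅₂ (Matrix.toLin' B) a b = 0) : B *ᵥ 𝔅₁ b = 0 := by
  have : 𝔅₂.repr (B *ᵥ 𝔅₁ b) = 0 := by
    ext a
    have := h a
    rw [LinearMap.toMatrix_apply, Matrix.toLin'_apply] at this
    simpa using this
  simpa using this

/-- Transfer of a common cokernel vector back from coordinates: if row `a` of `[B]_{𝔅₁ 𝔅₂}`
vanishes then `w ᵥ* B = 0` for the coordinate vector `w` of the functional `𝔅₂.coord a`. [folklore] -/
private theorem vecMul_eq_zero_of_row_eq_zero {ι : Type*} [Fintype ι] [DecidableEq ι]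
    (𝔅₁ 𝔅₂ : Basis ι ℂ (Fin n → ℂ)) (B : Matrix (Fin n) (Fin n) ℂ) (a : ι)
    (h : ∀ b, LinearMap.toMatrix 𝔅₁ 𝔅₂ (Matrix.toLin' B) a b = 0) :
    (fun k => 𝔅₂.coord a (Pi.single k 1)) ᵥ* B = 0 := by
  set ω := 𝔅₂.coord a with hω
  -- `ω ∘ B = 0` on the basis `𝔅₁`, hence everywhere
  have hωB : ω ∘ₗ Matrix.toLin' B = 0 := by
    refine 𝔅₁.ext fun b => ?_
    have := h b
    rw [LinearMap.toMatrix_apply] at this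
    simpa [hω] using this
  have hωw : ∀ y : Fin n → ℂ, ω y = (fun k => ω (Pi.single k 1)) ⬝ᵥ y := by
    intro y
    conv_lhs => rw [← Finset.univ_sum_single y]
    rw [map_sum, dotProduct]
    refine Finset.sum_congr rfl fun k _ => ?_
    have hk : (Pi.single k (y k) : Fin n → ℂ) = y k • (Pi.single k 1 : Fin n → ℂ) := by
      rw [← Pi.single_smul', smul_eq_mul, mul_one]
    rw [hk, map_smul, smul_eq_mul, mul_comm]
  funext k
  rw [Pi.zero_apply]
  have h1 : ((fun k => ω (Pi.single k 1)) ᵥ* B) k =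
      (fun k => ω (Pi.single k 1)) ⬝ᵥ (B *ᵥ Pi.single k 1) := by
    simp [vecMul, dotProduct, mulVec, Pi.single_apply]
  rw [h1, ← hωw]
  have := congrArg (fun g : (Fin n → ℂ) →ₗ[ℂ] ℂ => g (Pi.single k 1)) hωB
  simpa using this

/-- The coordinate vector of `𝔅₂.coord a` is nonzero. [folklore] -/
private theorem coordVec_ne_zero {ι : Type*} [Fintype ι] [DecidableEq ι]
    (𝔅₂ : Basis ι ℂ (Fin n → ℂ)) (a : ι) : (fun k => 𝔅₂.coord a (Pi.single k 1)) ≠ 0 := by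
  intro h
  have hω : 𝔅₂.coord a = 0 := by
    refine (Pi.basisFun ℂ (Fin n)).ext fun k => ?_
    have := congrFun h k
    simpa using this
  have := congrArg (fun g : (Fin n → ℂ) →ₗ[ℂ] ℂ => g (𝔅₂ a)) hω
  simp at this

end NormalForm

/-! ### A maximal-rank element; singular matrices have rank `≤ n - 1` -/

section MaxRank

variable {n : ℕ}

/-- Every linear subspace of `M_n(ℂ)` has a member of maximal rank. [folklore] -/
private theorem exists_max_rank (W : Submodule ℂ (Matrix (Fin n) (Fin n) ℂ)) :
    ∃ A₀ ∈ W, ∀ B ∈ W, B.rank ≤ A₀.rank := by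
  classical
  let P : ℕ → Prop := fun k => ∃ A ∈ W, A.rank = k
  have hP0 : P 0 := ⟨0, W.zero_mem, Matrix.rank_zero⟩
  obtain ⟨A₀, hA₀, hA₀r⟩ : P (Nat.findGreatest P n) := Nat.findGreatest_spec (Nat.zero_le n) hP0
  refine ⟨A₀, hA₀, fun B hB => ?_⟩
  rw [hA₀r]
  exact Nat.le_findGreatest (Matrix.rank_le_width B) ⟨B, hB, rfl⟩

/-- A singular square matrix has rank `≤ n - 1`. [folklore] -/
private theorem rank_le_of_det_eq_zero {A : Matrix (Fin n) (Fin n) ℂ} (h : A.det = 0) :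
    A.rank ≤ n - 1 := by
  have h1 : A.rank ≤ n := Matrix.rank_le_width A
  have h2 : A.rank ≠ n := by
    intro hr
    have hu := isUnit_of_rank_eq (A := A) (by rw [hr, Fintype.card_fin])
    rw [Matrix.isUnit_iff_isUnit_det, h] at hu
    exact not_isUnit_zero hu
  omega

end MaxRank

end Flanders

/-! ### The theorems -/

section Main

open Flanders

variable {n : ℕ}

/-- **Flanders 1962, Thm. 1 (the bound), square complex case.** If `A₀ ∈ W` has maximal rank
among the members of a linear subspace `W ≤ M_n(ℂ)`, then `dim W ≤ rank A₀ · n` ("Let `𝒱` be a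
rank-`r̄` linear subspace of `Mat_{n,p}(𝔽)`. Then `dim 𝒱 ≤ nr`").
[cite: Flanders1962, Thm. 1] [cite: deSeguinsPazzis2015Flanders, Thm. 1 (arXiv p0003.txt:L37-L41)] -/
theorem finrank_le_rank_mul_of_forall_rank_le (W : Submodule ℂ (Matrix (Fin n) (Fin n) ℂ))
    {A₀ : Matrix (Fin n) (Fin n) ℂ} (hA₀ : A₀ ∈ W) (hmax : ∀ B ∈ W, B.rank ≤ A₀.rank) :
    finrank ℂ W ≤ A₀.rank * n := by
  classical
  set r := A₀.rank with hr
  have hrn : r ≤ n := Matrix.rank_le_width A₀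
  obtain ⟨𝔅₁, 𝔅₂, hJ⟩ := exists_bases_toMatrix_eq_J A₀ hr.symm (Nat.add_sub_cancel' hrn)
  let L : Matrix (Fin n) (Fin n) ℂ ≃ₗ[ℂ] Matrix (Fin r ⊕ Fin (n - r)) (Fin r ⊕ Fin (n - r)) ℂ :=
    Matrix.toLin' ≪≫ₗ LinearMap.toMatrix 𝔅₁ 𝔅₂
  have hJW : J r (n - r) ∈ W.map L.toLinearMap := ⟨A₀, hA₀, hJ⟩
  have hmax' : ∀ B' ∈ W.map L.toLinearMap, B'.rank ≤ (J r (n - r)).rank := by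
    rintro _ ⟨B, hB, rfl⟩
    rw [← hJ]
    change (LinearMap.toMatrix 𝔅₁ 𝔅₂ (Matrix.toLin' B)).rank ≤
      (LinearMap.toMatrix 𝔅₁ 𝔅₂ (Matrix.toLin' A₀)).rank
    rw [rank_toMatrix_toLin', rank_toMatrix_toLin']
    exact hmax B hB
  have h1 := finrank_le (W.map L.toLinearMap) hJW hmax'
  rw [LinearEquiv.finrank_map_eq] at h1
  calc finrank ℂ W ≤ r * r + (n - r) * r := h1
    _ = (r + (n - r)) * r := (add_mul r (n - r) r).symm
    _ = r * n := by rw [Nat.add_sub_cancel' hrn, mul_comm]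

/-- **Dieudonné 1949 (the bound).** A linear subspace of `M_n(ℂ)` all of whose members are
singular has dimension at most `n(n-1)` (Flanders' theorem at `r = n - 1`).
[cite: Dieudonne1948, main theorem] [cite: Flanders1962, Thm. 1] [cite: deSeguinsPazzis2015Flanders, Thm. 1 and p. 3 (arXiv p0003.txt:L45-L46)] -/
theorem finrank_le_of_forall_det_eq_zero (W : Submodule ℂ (Matrix (Fin n) (Fin n) ℂ))
    (hW : ∀ A ∈ W, A.det = 0) : finrank ℂ W ≤ n * (n - 1) := by
  obtain ⟨A₀, hA₀, hmax⟩ := exists_max_rank W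
  calc finrank ℂ W ≤ A₀.rank * n := finrank_le_rank_mul_of_forall_rank_le W hA₀ hmax
    _ ≤ (n - 1) * n := Nat.mul_le_mul_right _ (rank_le_of_det_eq_zero (hW A₀ hA₀))
    _ = n * (n - 1) := mul_comm _ _

/-- **Dieudonné 1949 / Flanders 1962 (the equality case).** If a linear subspace of `M_n(ℂ)` of
singular matrices has dimension exactly `n(n-1)`, then either all its members kill a common
nonzero vector (`W ≤ {A | A v = 0}`) or a common nonzero covector (`W ≤ {A | wᵀ A = 0}`)
("if equality holds then either `𝒱` is equivalent to `ℛ(0,r)`, or `n = p` and `𝒱` is equivalent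
to `ℛ(r,0)`", at `r = n - 1`).
[cite: Dieudonne1948, main theorem] [cite: Flanders1962, Thm. 1] [cite: deSeguinsPazzis2015Flanders, Thm. 1 (arXiv p0003.txt:L37-L41)] -/
theorem exists_mulVec_eq_zero_or_vecMul_eq_zero_of_finrank_eq
    (W : Submodule ℂ (Matrix (Fin n) (Fin n) ℂ)) (hW : ∀ A ∈ W, A.det = 0)
    (hdim : finrank ℂ W = n * (n - 1)) :
    (∃ v : Fin n → ℂ, v ≠ 0 ∧ ∀ A ∈ W, A *ᵥ v = 0) ∨
      (∃ w : Fin n → ℂ, w ≠ 0 ∧ ∀ A ∈ W, w ᵥ* A = 0) := by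
  classical
  rcases Nat.eq_zero_or_pos n with hn | hn
  · exfalso
    subst hn
    have := hW 0 W.zero_mem
    simp at this
  obtain ⟨A₀, hA₀, hmax⟩ := exists_max_rank W
  have h1 := finrank_le_rank_mul_of_forall_rank_le W hA₀ hmax
  have h2 := rank_le_of_det_eq_zero (hW A₀ hA₀)
  have hr : A₀.rank = n - 1 := by
    refine le_antisymm h2 ?_
    rw [hdim, mul_comm] at h1
    exact Nat.le_of_mul_le_mul_right h1 hn
  obtain ⟨𝔅₁, 𝔅₂, hJ⟩ := exists_bases_toMatrix_eq_J A₀ hr (show n - 1 + 1 = n by omega)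
  let L : Matrix (Fin n) (Fin n) ℂ ≃ₗ[ℂ] Matrix (Fin (n - 1) ⊕ Fin 1) (Fin (n - 1) ⊕ Fin 1) ℂ :=
    Matrix.toLin' ≪≫ₗ LinearMap.toMatrix 𝔅₁ 𝔅₂
  have hJW : J (n - 1) 1 ∈ W.map L.toLinearMap := ⟨A₀, hA₀, hJ⟩
  have hmax' : ∀ B' ∈ W.map L.toLinearMap, B'.rank ≤ (J (n - 1) 1).rank := by
    rintro _ ⟨B, hB, rfl⟩
    rw [← hJ]
    change (LinearMap.toMatrix 𝔅₁ 𝔅₂ (Matrix.toLin' B)).rank ≤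
      (LinearMap.toMatrix 𝔅₁ 𝔅₂ (Matrix.toLin' A₀)).rank
    rw [rank_toMatrix_toLin', rank_toMatrix_toLin']
    exact hmax B hB
  have hdim' : finrank ℂ (W.map L.toLinearMap) = (n - 1) * ((n - 1) + 1) := by
    rw [LinearEquiv.finrank_map_eq, hdim, show n - 1 + 1 = n by omega, mul_comm]
  rcases col_eq_zero_or_row_eq_zero (W.map L.toLinearMap) hJW hmax' hdim' with hcol | hrow
  · left
    refine ⟨𝔅₁ (Sum.inr 0), 𝔅₁.ne_zero _, fun A hA => ?_⟩
    exact mulVec_eq_zero_of_col_eq_zero 𝔅₁ 𝔅₂ A (Sum.inr 0) fun a => hcol _ ⟨A, hA, rfl⟩ a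
  · right
    refine ⟨fun k => 𝔅₂.coord (Sum.inr 0) (Pi.single k 1), coordVec_ne_zero 𝔅₂ _, fun A hA => ?_⟩
    exact vecMul_eq_zero_of_row_eq_zero 𝔅₁ 𝔅₂ A (Sum.inr 0) fun b => hrow _ ⟨A, hA, rfl⟩ b

/-- Corollary used for maximal subspaces: a singular subspace of dimension `n(n-1)` IS one of the
spaces `{A | A v = 0}`, `{A | wᵀ A = 0}` (as sets), since it is contained in one of them and these
have dimension `n(n-1)` too. Stated as: membership is CHARACTERISED by the kernel condition.
[cite: Dieudonne1948, main theorem] [cite: Flanders1962, Thm. 1] -/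
theorem exists_forall_mem_iff_of_finrank_eq (W : Submodule ℂ (Matrix (Fin n) (Fin n) ℂ))
    (hW : ∀ A ∈ W, A.det = 0) (hdim : finrank ℂ W = n * (n - 1)) :
    (∃ v : Fin n → ℂ, v ≠ 0 ∧ ∀ A, A ∈ W ↔ A *ᵥ v = 0) ∨
      (∃ w : Fin n → ℂ, w ≠ 0 ∧ ∀ A, A ∈ W ↔ w ᵥ* A = 0) := by
  classical
  rcases exists_mulVec_eq_zero_or_vecMul_eq_zero_of_finrank_eq W hW hdim with
    ⟨v, hv, hWv⟩ | ⟨w, hw, hWw⟩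
  · left
    refine ⟨v, hv, ?_⟩
    -- `W ≤ K_v := ker (A ↦ A v)` and `dim K_v = n(n-1)` force equality
    let φ : Matrix (Fin n) (Fin n) ℂ →ₗ[ℂ] (Fin n → ℂ) :=
      { toFun := fun A => A *ᵥ v, map_add' := fun A B => add_mulVec A B v,
        map_smul' := fun c A => by rw [smul_mulVec, RingHom.id_apply] }
    have hle : W ≤ LinearMap.ker φ := fun A hA => (LinearMap.mem_ker).2 (hWv A hA)
    have hsurj : Function.Surjective φ := by
      intro y
      obtain ⟨i, hi⟩ : ∃ i, v i ≠ 0 := Function.ne_iff.1 hv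
      refine ⟨Matrix.of fun a b => if b = i then y a / v i else 0, ?_⟩
      funext a
      show ((Matrix.of fun a b => if b = i then y a / v i else 0) *ᵥ v) a = y a
      simp [mulVec, dotProduct, Finset.sum_ite_eq', div_mul_cancel₀ _ hi]
    have hker : finrank ℂ (LinearMap.ker φ) = n * (n - 1) := by
      have h1 := LinearMap.finrank_range_add_finrank_ker φ
      rw [LinearMap.range_eq_top.2 hsurj, finrank_top, Module.finrank_fin_fun,
        Module.finrank_matrix] at h1
      simp only [Fintype.card_fin, Module.finrank_self, mul_one] at h1
      rcases Nat.eq_zero_or_pos n with hn | hn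
      · subst hn; simp at h1 ⊢; omega
      · have : n * n = n * (n - 1) + n := by
          cases n with
          | zero => omega
          | succ k => simp; ring
        omega
    have heq : W = LinearMap.ker φ :=
      Submodule.eq_of_le_of_finrank_eq hle (by rw [hdim, hker])
    intro A
    rw [heq, LinearMap.mem_ker]
    rfl
  · right
    refine ⟨w, hw, ?_⟩
    let φ : Matrix (Fin n) (Fin n) ℂ →ₗ[ℂ] (Fin n → ℂ) :=
      { toFun := fun A => w ᵥ* A, map_add' := fun A B => vecMul_add A B w,
        map_smul' := fun c A => by rw [vecMul_smul w c A, RingHom.id_apply] }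
    have hle : W ≤ LinearMap.ker φ := fun A hA => (LinearMap.mem_ker).2 (hWw A hA)
    have hsurj : Function.Surjective φ := by
      intro y
      obtain ⟨i, hi⟩ : ∃ i, w i ≠ 0 := Function.ne_iff.1 hw
      refine ⟨Matrix.of fun a b => if a = i then y b / w i else 0, ?_⟩
      funext b
      show (w ᵥ* Matrix.of fun a b => if a = i then y b / w i else 0) b = y b
      simp [vecMul, dotProduct, Finset.sum_ite_eq', mul_div_cancel₀ _ hi]
    have hker : finrank ℂ (LinearMap.ker φ) = n * (n - 1) := by
      have h1 := LinearMap.finrank_range_add_finrank_ker φ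
      rw [LinearMap.range_eq_top.2 hsurj, finrank_top, Module.finrank_fin_fun,
        Module.finrank_matrix] at h1
      simp only [Fintype.card_fin, Module.finrank_self, mul_one] at h1
      rcases Nat.eq_zero_or_pos n with hn | hn
      · subst hn; simp at h1 ⊢; omega
      · have : n * n = n * (n - 1) + n := by
          cases n with
          | zero => omega
          | succ k => simp; ring
        omega
    have heq : W = LinearMap.ker φ :=
      Submodule.eq_of_le_of_finrank_eq hle (by rw [hdim, hker])
    intro A
    rw [heq, LinearMap.mem_ker]
    rfl

end Main

end Literature.LinearAlgebra

end
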